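import Literature.NumberTheory.Automorphic.ArchEndoscopicChartOrbLocal      -- ★ p850124 FILE D2 (LH3-p03 (g3)): `chartOrbHLoc`, `chartHaarHLoc`, `chartBoxImgLoc`; brings ★ D1 `chartTorusHLoc`, `mem_chartTorusH_iff_forall_mem_chartTorusHLoc`, ★ (T-MEAS), ★ `chartOrbH_eq_of_isHaarMeasure`
import Literature.MeasureTheory.Group.InvariantQuotientPiTopFactor         -- ★ p850180 (LH3-p03 (g3)): `exists_haar_quotientMeasure_prod_pi_top` (the generic package)
import Literature.MeasureTheory.Group.InvariantQuotientCompactSubgroup      -- ★ `integral_quotientMeasure_eq_inv_smul` (compact subgroup: `μ_{G/H} = ρ(H)⁻¹ • π_* ν`)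
import HarnessLib

/-!
# `chartOrbH = Π_w chartOrbHLoc` — the chart orbital functional of `H_∞` on product test functions is the product of the local chart orbital functionals
# ((PROD-QUOT-H) FILE P of the LH3 direct road: Borel–Jacquet 1979 §4.1, Rogawski 1990 §8.2–8.3, Shelstad 1979 §4, Folland 1995 §2.6, Gelbart 1975 (10.19))

Topic `NumberTheory/Automorphic`; namespace `Literature.NumberTheory.Automorphic.UnitaryGroup`.  THEOREMS ONLY (no `def`, no instance, no notation, no axiom, no
`sorry`).  Cell `pub/hodgecm-mathlib`, crux H413 (`stmt-HodgeConjecture-24833`), F0∕P3c line LH3 (closer stub `stub_N9`, DIRECT ROAD), organ «(PROD-QUOT-H)» (LH3-plan (g2)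
deal 2026-09-02T06:53:06Z to LH3-p03 (g3)); the head (P1) of the organ.  Count-neutral.

THE SETTING.  `H_∞ = A × B`, `A = U(Φ₂)(L⁺ ⊗ ℝ)`, `B = U(Φ₁)(L⁺ ⊗ ℝ)`; the place decomposition `eA = archPiEquivCM 2 L Φ₂ : A ≃ₜ* Π_w U(Φ₂)_w` (★); the chart torus
`T_S = chartTorusH L S` is PLACEWISE in `A` and contains ALL of `B` (★ `mem_chartTorusH_iff_forall_mem_chartTorusHLoc`, FILE D1), with local tori `T_{S,w} = chartTorusHLoc L S w`
(★ D1) and local functionals `chartOrbHLoc L S w ν_w f cw = dt_w(B_{S,w}) · ∫_{U(Φ₂)_w ⧸ T_{S,w}} f(x · endoBlockAt S w cw · x⁻¹) d(ν_w∕dt_w)` (★ D2).  PRODUCT-MEASURE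
CONVENTION (as ★ (V7) `ArchTorusOrbitalFubini`): per-place Haar measures `ν_w` on `U(Φ₂)_w`, a Haar measure `ν_B` on the compact abelian `B`, and
`νH = (eA⁻¹_* ⊗_w ν_w) ⊗ ν_B` on `H_∞` — every Haar measure on `H_∞` is a positive multiple of it, and `chartOrbH` is linear in `νH`.
* §1 `isInvInvariant_of_isHaarMeasure_archOne` — Haar measures on `B = U(Φ₁)_∞ = Π_w U(1)` are inversion invariant (`B` is abelian: `archOne_mul_comm`), so the generic
  package applies with `ν_B` any Haar measure.
* §2 `chartBoxImg_eq_setOf_forall_mem_chartBoxImgLoc` — the box image `B_S ⊆ T_S` of (T-MEAS) is, place by place, the product of the local box images `B_{S,w}`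
  (the `U(Φ₁)`-angles of the box fill `B`: every element of `U(1)` is `e^{iφ}`, `φ ∈ [0, 2π]`).
* §3 **`chartOrbH_eq_prod_chartOrbHLoc`** — THE HEAD (P1): for a PRODUCT test function `fH (a, b) = (Π_w f_w ((eA a)_w)) · g b` and EVERY coordinate `c` (no
  regularity, no integrability hypothesis),
  `chartOrbH L νH S fH c = ν_B(B) · g((endoTorus L S c).2) · Π_w chartOrbHLoc L S w ν_w f_w (c w)`
  — ★ `chartOrbH_eq_of_isHaarMeasure` (Haar-freeness) with the transported product torus measure of ★ `exists_haar_quotientMeasure_prod_pi_top`, whose (mass) clause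
  reads the box prefactor as `(Π_w dt_w(B_{S,w})) · ν_B(B)` and whose (product) clause factors the quotient integral; the local prefactors and local integrals
  recombine into the `chartOrbHLoc` (`Finset.prod_mul_distrib`).  With it the jump datum `jcH S w` of the `H`-side family (organ J of the line) is pinned by ONE product
  test function and becomes a one-place computation on `U(Φ₂)_w` (★ (K0±)-U11 `ArchRankOneJumpZero`, (A0)-U11).
* §4 (ED. 2) **(P4) AT A COMPACT PLACE `w ∉ S` THE LOCAL FUNCTIONAL IS THE WHOLE-GROUP ORBITAL INTEGRAL**: `chartBoxImgLoc_eq_univ_of_not_mem` (both slots are angles, so the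
  local box image is ALL of the compact Cayley torus `T_{S,w}`), `compactSpace_chartTorusHLoc_of_not_mem`, and
  **`chartOrbHLoc_eq_integral_of_not_mem : chartOrbHLoc L S w ν_w f cw = ∫_{U(Φ₂)_w} f(h · endoBlockAt S w cw · h⁻¹) dν_w(h)`** (`w ∉ S`, `f` measurable; ★
  `integral_quotientMeasure_eq_inv_smul`: the prefactor `dt_w(B_{S,w}) = dt_w(T_{S,w})` cancels the compact-subgroup normalisation EXACTLY) — the whole-`U(Φ₂)_w` currency of
  the rank-one letters ★ (K0±)-U11 `ArchRankOneJumpZero` ∕ `…Stable`, up to the Cayley frame of `U(Φ₂)_w`.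
HONEST LABEL: HC_CM is proved only modulo the 7 printed citations (2 remaining: hLiu418 = `stmt-HodgeConjecture-24832`, h413 = `stmt-HodgeConjecture-24833`) until rung 0
closes; measure-theoretic bookkeeping, moves no row of the books.

## References
* [BorelJacquet1979] A. Borel, H. Jacquet, *Automorphic forms and automorphic representations*, PSPM 33.1 (1979), §4.1 (`G_∞ = Π_v G(F_v)`, product measures).
* [Rogawski1990] J. D. Rogawski, *Automorphic Representations of Unitary Groups in Three Variables*, Ann. of Math. Stud. 123 (1990), §4.9 p. 54, §8.2 p. 122, §8.3 p. 124.
* [Shelstad1979] D. Shelstad, *Characters and inner forms of a quasi-split group over ℝ*, Compositio Math. 39 (1979), §4 pp. 22–23 (`T`, `dt`, `Φ^T_f`).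
* [Folland1995] G. B. Folland, *A Course in Abstract Harmonic Analysis* (1995), §2.2, §2.6 Thm. 2.49, (2.52).
* [DeitmarEchterhoff2014] A. Deitmar, S. Echterhoff, *Principles of Harmonic Analysis*, 2nd ed. (2014), Thm. 1.5.3, Cor. 1.5.4.
* [Gelbart1975] S. Gelbart, *Automorphic forms on adele groups*, Ann. of Math. Studies 83 (1975), §10, p. 155, (10.19).
-/

set_option autoImplicit false

noncomputable section

open MeasureTheory MeasureTheory.Measure NumberField NumberField.InfinitePlace Matrix Complex Topology
open Literature.MeasureTheory.Group
open scoped MatrixGroups Matrix Classical ENNReal NNReal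

namespace Literature.NumberTheory.Automorphic.UnitaryGroup

/-! ## §1 `B = U(Φ₁)_∞` is abelian; its Haar measures are inversion invariant -/

section ArchOne

variable (L : Type) [Field L] [NumberField L] [IsCMField L]

omit [NumberField L] [IsCMField L] in
/-- `GL₁(ℂ)` is commutative. [folklore] -/
private theorem gl_one_mul_comm (g h : GL (Fin 1) ℂ) : g * h = h * g := by
  refine Units.ext ?_
  rw [Units.val_mul, Units.val_mul]
  ext i j
  fin_cases i; fin_cases j
  simp [Matrix.mul_apply, mul_comm]

/-- **`B = U(Φ₁)(L⁺ ⊗ ℝ) ≃ Π_w U(1)` is abelian.** [cite: Rogawski1990, §4.9 p. 54] -/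
theorem archOne_mul_comm (b b' : ↥(arch (↥(maximalRealSubfield L)) L (IsCMField.complexConj L) 1 (Matrix.of fun i j : Fin 1 => if i.val + j.val + 1 = 1 then (1 : L) else 0))) :
    b * b' = b' * b := by
  apply (archPiEquivCM 1 L (Matrix.of fun i j : Fin 1 => if i.val + j.val + 1 = 1 then (1 : L) else 0)).injective
  rw [map_mul, map_mul]
  funext w
  apply Subtype.ext
  simp only [Pi.mul_apply, Subgroup.coe_mul]
  exact gl_one_mul_comm _ _

variable [MeasurableSpace ↥(arch (↥(maximalRealSubfield L)) L (IsCMField.complexConj L) 1 (Matrix.of fun i j : Fin 1 => if i.val + j.val + 1 = 1 then (1 : L) else 0))]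
  [BorelSpace ↥(arch (↥(maximalRealSubfield L)) L (IsCMField.complexConj L) 1 (Matrix.of fun i j : Fin 1 => if i.val + j.val + 1 = 1 then (1 : L) else 0))]

/-- **Every Haar measure on `B = U(Φ₁)_∞` is inversion invariant** (abelian group; Mathlib `IsHaarMeasure.isInvInvariant_of_innerRegular`). [cite: Folland1995, §2.2] -/
theorem isInvInvariant_of_isHaarMeasure_archOne
    (νB : Measure ↥(arch (↥(maximalRealSubfield L)) L (IsCMField.complexConj L) 1 (Matrix.of fun i j : Fin 1 => if i.val + j.val + 1 = 1 then (1 : L) else 0))) [νB.IsHaarMeasure] :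
    νB.IsInvInvariant := by
  letI : CommGroup ↥(arch (↥(maximalRealSubfield L)) L (IsCMField.complexConj L) 1 (Matrix.of fun i j : Fin 1 => if i.val + j.val + 1 = 1 then (1 : L) else 0)) :=
    { (inferInstance : Group ↥(arch (↥(maximalRealSubfield L)) L (IsCMField.complexConj L) 1 (Matrix.of fun i j : Fin 1 => if i.val + j.val + 1 = 1 then (1 : L) else 0))) with
      mul_comm := archOne_mul_comm L }
  exact IsHaarMeasure.isInvInvariant_of_innerRegular νB

end ArchOne

/-! ## §2 The box image is the product of the local box images -/

section Box

variable (L : Type) [Field L] [NumberField L] [IsCMField L] (S : Finset {w : InfinitePlace L // IsComplex w})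

/-- **The box image `B_S ⊆ T_S` is placewise the product of the local box images**: `m ∈ B_S ↔ ∀ w, (eA m.1)_w ∈ B_{S,w}` (the `U(Φ₁)`-component is unconstrained:
the angle slot `1` of the box is `[0, 2π]` and `φ ↦ e^{iφ}` maps it ONTO `U(1)`). [cite: Rogawski1990, §8.2 p. 122; §4.9 p. 54] [cite: Folland1995, §2.2] -/
theorem chartBoxImg_eq_setOf_forall_mem_chartBoxImgLoc :
    chartBoxImg L S = {m : ↥(chartTorusH L S) | ∀ w : {w : InfinitePlace L // IsComplex w},
      (⟨archPiEquivCM 2 L (Matrix.of fun i j : Fin 2 => if i.val + j.val + 1 = 2 then (1 : L) else 0) m.1.1 w,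
          (mem_chartTorusH_iff_forall_mem_chartTorusHLoc L S _).1 m.2 w⟩ : ↥(chartTorusHLoc L S w)) ∈ chartBoxImgLoc L S w} := by
  ext m
  simp only [Set.mem_setOf_eq, mem_chartBoxImgLoc_iff]
  constructor
  · rintro ⟨c, hc, rfl⟩ w
    refine ⟨c w, ?_, ?_⟩
    · rw [chartBox_eq_pi_chartBoxLoc] at hc
      exact hc w (Set.mem_univ w)
    · simp only [archPiEquivCM_endoTorus_fst, endoBlock_eq_endoBlockAt]
  · intro h
    choose cw hcw hcweq using h
    -- the `U(Φ₁)`-angles, reduced into `[0, 2π)`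
    have hφ : ∀ w : {w : InfinitePlace L // IsComplex w}, ∃ φ : ℝ, φ ∈ Set.Ico 0 (2 * Real.pi) ∧
        ((archPiEquivCM 1 L (Matrix.of fun i j : Fin 1 => if i.val + j.val + 1 = 1 then (1 : L) else 0) m.1.2 w :
          ↥(archLocal L 1 (Matrix.of fun i j : Fin 1 => if i.val + j.val + 1 = 1 then (1 : L) else 0) w)) : GL (Fin 1) ℂ) = circleDiagonal 1 ![Circle.exp φ] := by
      intro w
      obtain ⟨φ, hφ⟩ := exists_eq_circleDiagonal_one L w _
      refine ⟨toIcoMod Real.two_pi_pos 0 φ, ?_, ?_⟩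
      · have h := toIcoMod_mem_Ico Real.two_pi_pos 0 φ
        rwa [zero_add] at h
      · rw [hφ]
        have he : Circle.exp φ = Circle.exp (toIcoMod Real.two_pi_pos 0 φ) := by
          rw [Circle.exp_eq_exp]
          exact ⟨toIcoDiv Real.two_pi_pos 0 φ, by rw [toIcoMod, zsmul_eq_mul]; ring⟩
        rw [he]
    choose φ hφI hφeq using hφ
    refine ⟨fun w => ![cw w 0, φ w, cw w 2], ?_, ?_⟩
    · rw [chartBox_eq_pi_chartBoxLoc]
      intro w _ i _
      have hb := hcw w
      fin_cases i
      · exact hb 0 (Set.mem_univ _)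
      · show ![cw w 0, φ w, cw w 2] 1 ∈ Set.Icc 0 (if w ∈ S ∧ (1 : Fin 3) = 0 then (1 : ℝ) else 2 * Real.pi)
        have h10 : ¬ (w ∈ S ∧ (1 : Fin 3) = 0) := fun h => absurd h.2 (by decide)
        rw [if_neg h10]
        exact ⟨(hφI w).1, (hφI w).2.le⟩
      · exact hb 2 (Set.mem_univ _)
    · apply Subtype.ext
      refine Prod.ext ?_ ?_
      · apply (archPiEquivCM 2 L (Matrix.of fun i j : Fin 2 => if i.val + j.val + 1 = 2 then (1 : L) else 0)).injective
        funext w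
        rw [archPiEquivCM_endoTorus_fst, endoBlock_eq_endoBlockAt, ← hcweq w]
        exact endoBlockAt_congr L S w rfl rfl
      · apply (archPiEquivCM 1 L (Matrix.of fun i j : Fin 1 => if i.val + j.val + 1 = 1 then (1 : L) else 0)).injective
        funext w
        rw [archPiEquivCM_endoTorus_snd]
        apply Subtype.ext
        rw [hφeq w]
        rfl

end Box

/-! ## §3 The head (P1): `chartOrbH = ν_B(B) · g · Π_w chartOrbHLoc` on product test functions -/

section Head

variable (L : Type) [Field L] [NumberField L] [IsCMField L] (S : Finset {w : InfinitePlace L // IsComplex w})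
  [∀ w : {w : InfinitePlace L // IsComplex w}, MeasurableSpace ↥(archLocal L 2 (Matrix.of fun i j : Fin 2 => if i.val + j.val + 1 = 2 then (1 : L) else 0) w)]
  [∀ w : {w : InfinitePlace L // IsComplex w}, BorelSpace ↥(archLocal L 2 (Matrix.of fun i j : Fin 2 => if i.val + j.val + 1 = 2 then (1 : L) else 0) w)]
  [MeasurableSpace ↥(arch (↥(maximalRealSubfield L)) L (IsCMField.complexConj L) 2 (Matrix.of fun i j : Fin 2 => if i.val + j.val + 1 = 2 then (1 : L) else 0))]
  [BorelSpace ↥(arch (↥(maximalRealSubfield L)) L (IsCMField.complexConj L) 2 (Matrix.of fun i j : Fin 2 => if i.val + j.val + 1 = 2 then (1 : L) else 0))]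
  [MeasurableSpace ↥(arch (↥(maximalRealSubfield L)) L (IsCMField.complexConj L) 1 (Matrix.of fun i j : Fin 1 => if i.val + j.val + 1 = 1 then (1 : L) else 0))]
  [BorelSpace ↥(arch (↥(maximalRealSubfield L)) L (IsCMField.complexConj L) 1 (Matrix.of fun i j : Fin 1 => if i.val + j.val + 1 = 1 then (1 : L) else 0))]
  (νw : ∀ w : {w : InfinitePlace L // IsComplex w}, Measure ↥(archLocal L 2 (Matrix.of fun i j : Fin 2 => if i.val + j.val + 1 = 2 then (1 : L) else 0) w))
  [∀ w, (νw w).IsHaarMeasure] [∀ w, (νw w).IsMulRightInvariant]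
  (νB : Measure ↥(arch (↥(maximalRealSubfield L)) L (IsCMField.complexConj L) 1 (Matrix.of fun i j : Fin 1 => if i.val + j.val + 1 = 1 then (1 : L) else 0)))
  [νB.IsHaarMeasure] [νB.IsMulRightInvariant]
  (νH : Measure (↥(arch (↥(maximalRealSubfield L)) L (IsCMField.complexConj L) 2 (Matrix.of fun i j : Fin 2 => if i.val + j.val + 1 = 2 then (1 : L) else 0)) ×
      ↥(arch (↥(maximalRealSubfield L)) L (IsCMField.complexConj L) 1 (Matrix.of fun i j : Fin 1 => if i.val + j.val + 1 = 1 then (1 : L) else 0))))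
  [νH.IsHaarMeasure] [νH.IsMulRightInvariant]
  (hν : νH = ((Measure.pi νw).map (archPiEquivCM 2 L (Matrix.of fun i j : Fin 2 => if i.val + j.val + 1 = 2 then (1 : L) else 0)).symm).prod νB)

include hν in
/-- **(P1) THE CHART ORBITAL FUNCTIONAL ON PRODUCT TEST FUNCTIONS IS THE PRODUCT OF THE LOCAL ONES.**  Under the product-measure convention
`νH = (eA⁻¹_* ⊗_w ν_w) ⊗ ν_B`, for every product test function `fH (a, b) = (Π_w f_w ((eA a)_w)) · g b` on `H_∞ = U(Φ₂)_∞ × U(Φ₁)_∞`, every Cartan label `S` and EVERY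
coordinate `c` (no regularity, no integrability hypothesis):
`chartOrbH L νH S fH c = ν_B(B) · g((endoTorus L S c).2) · Π_w chartOrbHLoc L S w ν_w f_w (c w)`.
(The `U(Φ₁)`-factor lies inside `T_S` and contributes only the value of `g` at the central component; the `U(Φ₂)`-factor splits over the places; the box prefactor
`dt(B_S) = (Π_w dt_w(B_{S,w})) · ν_B(B)` splits alongside.) [cite: BorelJacquet1979, §4.1] [cite: Rogawski1990, §8.2 p. 122; §8.3 p. 124] [cite: Shelstad1979, §4 p. 22]
[cite: Folland1995, §2.6 Thm. 2.49, (2.52)] [cite: Gelbart1975, p. 155 (10.19)] -/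
theorem chartOrbH_eq_prod_chartOrbHLoc
    (fH : ↥(arch (↥(maximalRealSubfield L)) L (IsCMField.complexConj L) 2 (Matrix.of fun i j : Fin 2 => if i.val + j.val + 1 = 2 then (1 : L) else 0)) ×
      ↥(arch (↥(maximalRealSubfield L)) L (IsCMField.complexConj L) 1 (Matrix.of fun i j : Fin 1 => if i.val + j.val + 1 = 1 then (1 : L) else 0)) → ℂ)
    (f : ∀ w : {w : InfinitePlace L // IsComplex w}, ↥(archLocal L 2 (Matrix.of fun i j : Fin 2 => if i.val + j.val + 1 = 2 then (1 : L) else 0) w) → ℂ)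
    (g : ↥(arch (↥(maximalRealSubfield L)) L (IsCMField.complexConj L) 1 (Matrix.of fun i j : Fin 1 => if i.val + j.val + 1 = 1 then (1 : L) else 0)) → ℂ)
    (hfH : ∀ a b, fH (a, b) = (∏ w, f w (archPiEquivCM 2 L (Matrix.of fun i j : Fin 2 => if i.val + j.val + 1 = 2 then (1 : L) else 0) a w)) * g b)
    (c : {w : InfinitePlace L // IsComplex w} → Fin 3 → ℝ) :
    chartOrbH L νH S fH c = (νB.real Set.univ : ℂ) * g (endoTorus L S c).2 * ∏ w, chartOrbHLoc L S w (νw w) (f w) (c w) := by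
  -- instances at the places and on the quotients
  haveI : ∀ w : {w : InfinitePlace L // IsComplex w}, LocallyCompactSpace ↥(archLocal L 2 (Matrix.of fun i j : Fin 2 => if i.val + j.val + 1 = 2 then (1 : L) else 0) w) :=
    fun w => locallyCompactSpace_archLocal_two L w
  haveI : ∀ w : {w : InfinitePlace L // IsComplex w}, SecondCountableTopology ↥(archLocal L 2 (Matrix.of fun i j : Fin 2 => if i.val + j.val + 1 = 2 then (1 : L) else 0) w) :=
    fun w => secondCountableTopology_archLocal_two L w
  letI : ∀ w : {w : InfinitePlace L // IsComplex w},
      MeasurableSpace (↥(archLocal L 2 (Matrix.of fun i j : Fin 2 => if i.val + j.val + 1 = 2 then (1 : L) else 0) w) ⧸ chartTorusHLoc L S w) := fun w => borel _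
  haveI : ∀ w : {w : InfinitePlace L // IsComplex w},
      BorelSpace (↥(archLocal L 2 (Matrix.of fun i j : Fin 2 => if i.val + j.val + 1 = 2 then (1 : L) else 0) w) ⧸ chartTorusHLoc L S w) := fun w => ⟨rfl⟩
  letI : MeasurableSpace ((↥(arch (↥(maximalRealSubfield L)) L (IsCMField.complexConj L) 2 (Matrix.of fun i j : Fin 2 => if i.val + j.val + 1 = 2 then (1 : L) else 0)) ×
      ↥(arch (↥(maximalRealSubfield L)) L (IsCMField.complexConj L) 1 (Matrix.of fun i j : Fin 1 => if i.val + j.val + 1 = 1 then (1 : L) else 0))) ⧸ chartTorusH L S) := borel _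
  haveI : BorelSpace ((↥(arch (↥(maximalRealSubfield L)) L (IsCMField.complexConj L) 2 (Matrix.of fun i j : Fin 2 => if i.val + j.val + 1 = 2 then (1 : L) else 0)) ×
      ↥(arch (↥(maximalRealSubfield L)) L (IsCMField.complexConj L) 1 (Matrix.of fun i j : Fin 1 => if i.val + j.val + 1 = 1 then (1 : L) else 0))) ⧸ chartTorusH L S) := ⟨rfl⟩
  haveI : ∀ w, (chartHaarHLoc L S w).IsHaarMeasure := fun w => isHaarMeasure_chartHaarHLoc L S w
  haveI : ∀ w, (chartHaarHLoc L S w).IsInvInvariant := fun w => isInvInvariant_chartHaarHLoc L S w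
  haveI : ∀ w, SigmaFinite (chartHaarHLoc L S w) := fun w => sigmaFinite_chartHaarHLoc L S w
  haveI : νB.IsInvInvariant := isInvInvariant_of_isHaarMeasure_archOne L νB
  haveI := locallyCompactSpace_chartTorusH L S
  -- the generic package
  obtain ⟨ρ, hρH, hρI, hmass, -, hprod⟩ := exists_haar_quotientMeasure_prod_pi_top
    (archPiEquivCM 2 L (Matrix.of fun i j : Fin 2 => if i.val + j.val + 1 = 2 then (1 : L) else 0))
    (fun w => chartTorusHLoc L S w) (fun w => isClosed_chartTorusHLoc L S w) (chartTorusH L S) (isClosed_chartTorusH L S)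
    (mem_chartTorusH_iff_forall_mem_chartTorusHLoc L S) (fun w => chartHaarHLoc L S w) νw νB νH hν
  -- the box prefactor
  have hbox : ρ (chartBoxImg L S) = (∏ w, chartHaarHLoc L S w (chartBoxImgLoc L S w)) * νB Set.univ := by
    rw [chartBoxImg_eq_setOf_forall_mem_chartBoxImgLoc L S]
    exact hmass fun w => chartBoxImgLoc L S w
  -- the quotient integral
  have hint : ∫ y, descConj (endoTorus L S c) (chartTorusH L S) (forall_mem_chartTorusH_comm L S c) fH y
      ∂(quotientMeasure (chartTorusH L S) ρ (isClosed_chartTorusH L S) νH) =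
      g (endoTorus L S c).2 * ∏ w, ∫ x, descConj (endoBlockAt L S w (c w)) (chartTorusHLoc L S w) (forall_mem_chartTorusHLoc_comm L S w (c w)) (f w) x
        ∂(quotientMeasure (chartTorusHLoc L S w) (chartHaarHLoc L S w) (isClosed_chartTorusHLoc L S w) (νw w)) :=
    hprod (fun w => endoBlockAt L S w (c w)) (endoTorus L S c).2 (fun w => forall_mem_chartTorusHLoc_comm L S w (c w))
      (forall_mem_chartTorusH_comm L S c) fH f g hfH
  -- the local functionals
  have hloc : ∀ w, chartOrbHLoc L S w (νw w) (f w) (c w) = ((chartHaarHLoc L S w (chartBoxImgLoc L S w)).toReal : ℂ) *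
      ∫ x, descConj (endoBlockAt L S w (c w)) (chartTorusHLoc L S w) (forall_mem_chartTorusHLoc_comm L S w (c w)) (f w) x
        ∂(quotientMeasure (chartTorusHLoc L S w) (chartHaarHLoc L S w) (isClosed_chartTorusHLoc L S w) (νw w)) := fun w => rfl
  rw [chartOrbH_eq_of_isHaarMeasure L S νH ρ fH c]
  show ((ρ (chartBoxImg L S)).toReal : ℂ) * ∫ y, descConj (endoTorus L S c) (chartTorusH L S) (forall_mem_chartTorusH_comm L S c) fH y
      ∂(quotientMeasure (chartTorusH L S) ρ (isClosed_chartTorusH L S) νH) = _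
  rw [hint, hbox, ENNReal.toReal_mul, ENNReal.toReal_prod, Complex.ofReal_mul, Complex.ofReal_prod]
  simp_rw [hloc]
  rw [Finset.prod_mul_distrib, measureReal_def]
  ring

end Head


/-! ## §4 (ED. 2) (P4): at a compact place the local functional is the whole-group orbital integral -/

section CompactPlace

variable (L : Type) [Field L] (S : Finset {w : InfinitePlace L // IsComplex w}) (w : {w : InfinitePlace L // IsComplex w})

/-- `e^{i·toIcoMod(x)} = e^{ix}`: reducing an angle into `[0, 2π)` does not change its point on the circle. [cite: Folland1995, §2.2] -/
theorem circleExp_toIcoMod (x : ℝ) : Circle.exp (toIcoMod Real.two_pi_pos 0 x) = Circle.exp x := by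
  rw [Circle.exp_eq_exp]
  exact ⟨-toIcoDiv Real.two_pi_pos 0 x, by rw [toIcoMod, zsmul_eq_mul]; push_cast; ring⟩

/-- At a COMPACT place `w ∉ S` the local chart reads both slots `0, 2` through `e^{i·}`: equal circle points give equal local chart points.
[cite: Rogawski1990, §8.2 p. 122] -/
theorem endoBlockAt_eq_of_not_mem_of_circleExp_eq (hw : w ∉ S) {cw cw' : Fin 3 → ℝ} (h0 : Circle.exp (cw 0) = Circle.exp (cw' 0))
    (h2 : Circle.exp (cw 2) = Circle.exp (cw' 2)) : endoBlockAt L S w cw = endoBlockAt L S w cw' := by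
  unfold endoBlockAt endoBlock
  rw [if_neg hw, if_neg hw]
  simp only [h0, h2]

variable [NumberField L] [IsCMField L]

/-- **At a compact place `w ∉ S` the local box image is the WHOLE local torus** (`B_{S,w} = T_{S,w}`: every element of the compact Cayley torus is a chart point with
both angles in `[0, 2π)`). [cite: Rogawski1990, §8.2 p. 122] [cite: Folland1995, §2.2] -/
theorem chartBoxImgLoc_eq_univ_of_not_mem (hw : w ∉ S) : chartBoxImgLoc L S w = Set.univ := by
  refine Set.eq_univ_of_forall fun t => ?_
  obtain ⟨cw, hcw⟩ := (mem_chartTorusHLoc_iff L S w t.1).1 t.2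
  rw [mem_chartBoxImgLoc_iff]
  refine ⟨![toIcoMod Real.two_pi_pos 0 (cw 0), 0, toIcoMod Real.two_pi_pos 0 (cw 2)], ?_, ?_⟩
  · intro i _
    have hi : ¬ (w ∈ S ∧ i = 0) := fun h => hw h.1
    show _ ∈ Set.Icc (0 : ℝ) (if w ∈ S ∧ i = 0 then (1 : ℝ) else 2 * Real.pi)
    rw [if_neg hi]
    have hI : ∀ x : ℝ, toIcoMod Real.two_pi_pos 0 x ∈ Set.Icc 0 (2 * Real.pi) := fun x => by
      have h := toIcoMod_mem_Ico Real.two_pi_pos 0 x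
      rw [zero_add] at h
      exact ⟨h.1, h.2.le⟩
    fin_cases i
    · exact hI (cw 0)
    · exact ⟨le_rfl, by positivity⟩
    · exact hI (cw 2)
  · rw [← hcw]
    exact endoBlockAt_eq_of_not_mem_of_circleExp_eq L S w hw (circleExp_toIcoMod (cw 0)) (circleExp_toIcoMod (cw 2))

/-- **At a compact place the local torus `T_{S,w}` is compact.** [cite: Rogawski1990, §8.2 p. 122] [cite: Shelstad1979, §4 p. 22] -/
theorem compactSpace_chartTorusHLoc_of_not_mem (hw : w ∉ S) : CompactSpace ↥(chartTorusHLoc L S w) :=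
  ⟨by rw [← chartBoxImgLoc_eq_univ_of_not_mem L S w hw]; exact isCompact_chartBoxImgLoc L S w⟩

variable [MeasurableSpace ↥(archLocal L 2 (Matrix.of fun i j : Fin 2 => if i.val + j.val + 1 = 2 then (1 : L) else 0) w)]
  [BorelSpace ↥(archLocal L 2 (Matrix.of fun i j : Fin 2 => if i.val + j.val + 1 = 2 then (1 : L) else 0) w)]
  (νw : Measure ↥(archLocal L 2 (Matrix.of fun i j : Fin 2 => if i.val + j.val + 1 = 2 then (1 : L) else 0) w)) [νw.IsHaarMeasure] [νw.IsMulRightInvariant]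

/-- **(P4) AT A COMPACT PLACE `w ∉ S` THE LOCAL CHART ORBITAL FUNCTIONAL IS THE WHOLE-GROUP ORBITAL INTEGRAL**:
`chartOrbHLoc L S w ν_w f cw = ∫_{U(Φ₂)_w} f(h · endoBlockAt S w cw · h⁻¹) dν_w(h)` for measurable `f` — the box prefactor `dt_w(B_{S,w}) = dt_w(T_{S,w})` cancels the
compact-subgroup normalisation `μ_{G⧸T} = dt_w(T)⁻¹ • π_* ν_w` (★ `integral_quotientMeasure_eq_inv_smul`) EXACTLY, with no constant left.  This is the currency of the rank-one letters
(★ `ArchRankOneJumpZero` ∕ `ArchRankOneJumpZeroStable`: `∫_{U(1,1)} f(h·t·h⁻¹) dμ`) up to the Cayley frame of `U(Φ₂)_w`. [cite: Rogawski1990, §8.2 p. 122; §8.3 p. 124]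
[cite: Folland1995, §2.6 (2.52)] [cite: DeitmarEchterhoff2014, Cor. 1.5.4] -/
theorem chartOrbHLoc_eq_integral_of_not_mem (hw : w ∉ S)
    (f : ↥(archLocal L 2 (Matrix.of fun i j : Fin 2 => if i.val + j.val + 1 = 2 then (1 : L) else 0) w) → ℂ) (hf : Measurable f) (cw : Fin 3 → ℝ) :
    chartOrbHLoc L S w νw f cw = ∫ h, f (h * endoBlockAt L S w cw * h⁻¹) ∂νw := by
  letI : MeasurableSpace (↥(archLocal L 2 (Matrix.of fun i j : Fin 2 => if i.val + j.val + 1 = 2 then (1 : L) else 0) w) ⧸ chartTorusHLoc L S w) := borel _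
  haveI : BorelSpace (↥(archLocal L 2 (Matrix.of fun i j : Fin 2 => if i.val + j.val + 1 = 2 then (1 : L) else 0) w) ⧸ chartTorusHLoc L S w) := ⟨rfl⟩
  haveI := locallyCompactSpace_archLocal_two L w
  haveI := secondCountableTopology_archLocal_two L w
  haveI := isHaarMeasure_chartHaarHLoc L S w
  haveI := isInvInvariant_chartHaarHLoc L S w
  haveI := sigmaFinite_chartHaarHLoc L S w
  haveI := compactSpace_chartTorusHLoc_of_not_mem L S w hw
  haveI : IsClosed (chartTorusHLoc L S w : Set ↥(archLocal L 2 (Matrix.of fun i j : Fin 2 => if i.val + j.val + 1 = 2 then (1 : L) else 0) w)) :=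
    isClosed_chartTorusHLoc L S w
  have hpos : (chartHaarHLoc L S w Set.univ).toReal ≠ 0 := by
    rw [← chartBoxImgLoc_eq_univ_of_not_mem L S w hw]
    exact (toReal_chartHaarHLoc_chartBoxImgLoc_pos L S w).ne'
  rw [chartOrbHLoc_def]
  show ((chartHaarHLoc L S w (chartBoxImgLoc L S w)).toReal : ℂ) *
      ∫ x, descConj (endoBlockAt L S w cw) (chartTorusHLoc L S w) (forall_mem_chartTorusHLoc_comm L S w cw) f x
        ∂(quotientMeasure (chartTorusHLoc L S w) (chartHaarHLoc L S w) (isClosed_chartTorusHLoc L S w) νw) = _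
  rw [integral_quotientMeasure_eq_inv_smul (chartTorusHLoc L S w) (chartHaarHLoc L S w) νw _
      (measurable_descConj (endoBlockAt L S w cw) (chartTorusHLoc L S w) (forall_mem_chartTorusHLoc_comm L S w cw) hf).stronglyMeasurable,
    chartBoxImgLoc_eq_univ_of_not_mem L S w hw, measureReal_def, Complex.real_smul, Complex.ofReal_inv, ← mul_assoc,
    mul_inv_cancel₀ (Complex.ofReal_ne_zero.mpr hpos), one_mul]
  simp only [descConj_mk]

end CompactPlace

end Literature.NumberTheory.Automorphic.UnitaryGroup

end
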